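import Summits.NavierStokesRegularity.NavierStokesRegularity.Theses.TypeILiouville
import Literature.Analysis.FluidPDE.SereginSverakPressureLocalTypeI
import Literature.Analysis.FluidPDE.LocalTypeIWeakSerrinProofs
import Literature.Analysis.FluidPDE.LocalTypeICongr
import HarnessLib

/-!
# Hard core `NoTypeII` (stmt-NavierStokesRegularity-0056): NECESSITY of the energy-Type-I slab bound —
# a Type-I RATE on the whole lifespan gives Albritton–Barker's `𝐈 < ∞` on a final slab
# (Lemma 2.5 / Remark 3.2 GLOBALISED; unit viscosity, lifespan `T ≥ 2`)

Helper file (theorems only) for the Type-II-exclusion estimate programme (D-0081 §B).  The registered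
residual `stub_energyTypeISlab` (S₁) of the line `Cruxes/TypeIliouvilleNoTypeII/Lines/eternal_split.lean`
asks that every maximal Leray–Hopf solution from rapidly decaying data be energy-Type-I on a final slab:
`𝐈((T - r², T) × ℝ³; u, p, ∇u) < ⊤`.  The tree has `S₁ ∧ EEL′ ⇒ NoTypeII` (`…NormalForm.lean`); this file
is the first half of the converse direction «NoTypeII ⇒ S₁» (K2 NECESSARY by name): for a classical unit-
viscosity solution on `[0, T)`, `T ≥ 2`, Leray–Hopf from its datum, which obeys the Type-I RATE
`‖u(t, x)‖ ≤ C/√(T - t)` on the WHOLE of `[0, T)`, Albritton–Barker's quantity (with Tao's gauge of the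
pressure) is finite on the final slab `(T - δ², T) × ℝ³`, `δ = 1/2`:

* `typeIBound_slab_le_of_rate_two_le` / `typeIBound_slab_lt_top_of_rate_two_le`.

Proof: Albritton–Barker 2019 Lemma 2.5 in the rate case (tree: `AlbrittonBarker2019.cknC_le_of_rate`,
`AlbrittonBarker2019.uniform_bound_of_interp`, `AlbrittonBarker2019.cknDOsc_le_four_mul_cknD`) run ONCE on
the region `Q = (T - 1, T) × ℝ³` (all of whose sub-balls have radius `≤ 1` and unit reference balls inside
`(0, T)` since `T ≥ 2`), with reference data at radii `≥ 1/2` that are UNIFORM in the centre: the energy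
class (`SereginSverak2002.eEnergy_le`), the global `L^{3/2}` bound of the gauged pressure
(`SereginSverak2002.lintegral_slab_gauged_pressure_lt_top`) and the total dissipation
(`SereginSverak2002.lintegral_slab_frobeniusNormSq_fderiv_lt_top'`); suitability with the gauged pressure is
`SereginSverak2002.isSuitableWeakSolutionOn_gauge_of_classical`.  The removal of `T ≥ 2` (Leray
similarity, `typeIBound_nsZoom`), the eventual-rate-to-whole-rate step (`IsTypeIBlowup.exists_sqrt_mul_norm_le`)
and the pressure swap `q ↔ p` in `D` (`cknDOsc_sub_fun_time`) are left to the companion assembly file.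

WHAT THIS IS NOT: not NS; a necessity rung for an OPEN residual. [folklore]
-/

noncomputable section

-- the summit and its single problem share the name (D-0017 nested layout)
set_option linter.dupNamespace false

open MeasureTheory Set Function Filter TopologicalSpace Metric
open scoped Topology NNReal ENNReal

namespace Summit.NavierStokesRegularity.NavierStokesRegularity.Theorems.TypeIliouvilleNoTypeII.EnergySlab

open Literature.Analysis Literature.Analysis.FluidPDE
open Literature.Analysis.FluidPDE.AlbrittonBarker2019

variable {T : ℝ} {u : ℝ → EuclideanSpace ℝ (Fin 3) → EuclideanSpace ℝ (Fin 3)}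
  {p : ℝ → EuclideanSpace ℝ (Fin 3) → ℝ}

/-- Margins of a parabolic ball inside a slab: if `Q(z, ρ) ⊆ (a, b) × ℝ³` with `ρ > 0` then
`a ≤ z.1 - ρ²` and `z.1 ≤ b`. [folklore] -/
theorem margins_of_subset_slab {a b ρ : ℝ} {z : ℝ × EuclideanSpace ℝ (Fin 3)} (hρ : 0 < ρ)
    (h : parabolicCylinder ρ z ⊆ Ioo a b ×ˢ (univ : Set (EuclideanSpace ℝ (Fin 3)))) :
    a ≤ z.1 - ρ ^ 2 ∧ z.1 ≤ b := by
  have hI : (Ioo (z.1 - ρ ^ 2) z.1).Nonempty := nonempty_Ioo.2 (by nlinarith)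
  have hB : (ball z.2 ρ).Nonempty := nonempty_ball.2 hρ
  have hsub : Ioo (z.1 - ρ ^ 2) z.1 ⊆ Ioo a b := by
    rcases prod_subset_prod_iff.1 h with h1 | h1 | h1
    · exact h1.1
    · exact absurd h1 hI.ne_empty
    · exact absurd h1 hB.ne_empty
  exact (Ioo_subset_Ioo_iff (by nlinarith)).1 hsub

/-- Enlarging the radius of a parabolic ball with the same top: `Q(z, ρ) ⊆ Q(z, R)` for `ρ ≤ R`.
[folklore] -/
theorem parabolicCylinder_mono_radius {ρ R : ℝ} (h : ρ ≤ R) (hρ : 0 ≤ ρ)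
    (z : ℝ × EuclideanSpace ℝ (Fin 3)) : parabolicCylinder ρ z ⊆ parabolicCylinder R z :=
  prod_mono (Ioo_subset_Ioo (by nlinarith) le_rfl) (ball_subset_ball h)

/-- **Type-I rate ⇒ energy-Type-I on a final slab** (Albritton–Barker 2019, Lemma 2.5 / Remark 3.2,
globalised; `ν = 1`, `T ≥ 2`).  Let `(u, p)` be a classical unit-viscosity solution of unforced
Navier–Stokes on `ℝ³ × [0, T)`, `T ≥ 2`, Leray–Hopf from its datum, with the Type-I rate
`‖u(t, x)‖ ≤ C/√(T - t)` for ALL `t ∈ [0, T)` and all `x` (`C ≥ 0`).  Then, with Tao's gauge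
`q(t, x) = p(t, x) - (p(t, 0) - P[u(t)](0))` of the pressure, Albritton–Barker's Type-I quantity of
`(u, q, ∇u)` on the final slab `(T - 1/4, T) × ℝ³` is finite. [cite: AlbrittonBarker2019, Lemma 2.5 and Remark 3.2] -/
theorem typeIBound_slab_lt_top_of_rate_two_le (hT2 : 2 ≤ T)
    (hsol : IsClassicalNSSolutionOn (Ico 0 T) 1 0 u p) (hLH : IsLerayHopfOn T 1 0 (u 0) u)
    {C : ℝ} (hC : 0 ≤ C) (hrate : ∀ t ∈ Ico 0 T, ∀ x, ‖u t x‖ ≤ C / Real.sqrt (T - t)) :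
    typeIBound (Ioo (T - 1 / 4) T ×ˢ (univ : Set (EuclideanSpace ℝ (Fin 3)))) u
      (fun t x => p t x - (p t 0 - normalisedPressure (u t) 0)) (fun t x => fderiv ℝ (u t) x) < ⊤ := by
  have hT : 0 < T := by linarith
  -- the gauged pressure and the working region `Q = (T - 1, T) × ℝ³`
  set q : ℝ → EuclideanSpace ℝ (Fin 3) → ℝ := fun t x => p t x - (p t 0 - normalisedPressure (u t) 0)
    with hq
  set QO : Opens (ℝ × EuclideanSpace ℝ (Fin 3)) :=
    ⟨Ioo (T - 1) T ×ˢ univ, isOpen_Ioo.prod isOpen_univ⟩ with hQO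
  have hQOcoe : (QO : Set (ℝ × EuclideanSpace ℝ (Fin 3))) = Ioo (T - 1) T ×ˢ univ := rfl
  have hQOslab : (QO : Set (ℝ × EuclideanSpace ℝ (Fin 3))) ⊆
      Ioo 0 T ×ˢ (univ : Set (EuclideanSpace ℝ (Fin 3))) := by
    rw [hQOcoe]; exact prod_mono (Ioo_subset_Ioo (by linarith) le_rfl) Subset.rfl
  -- suitability with the gauged pressure and the classical weak gradient
  have hsw : IsSuitableWeakSolutionOn QO 1 0 u q :=
    SereginSverak2002.isSuitableWeakSolutionOn_gauge_of_classical one_pos hT hsol hLH QO hQOslab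
  have hG : HasWeakSpatialGradientOn QO u fun t x => fderiv ℝ (u t) x :=
    hasWeakSpatialGradientOn_of_contDiffOn isOpen_Ioo hQOslab
      ((SereginSverak2002.classical_Ioo hsol).smooth_velocity.of_le (by norm_cast))
  -- continuity of `u` on `(0, T) × ℝ³`
  have hcontu : ContinuousOn (uncurry u) (Ioo 0 T ×ˢ (univ : Set (EuclideanSpace ℝ (Fin 3)))) :=
    (SereginSverak2002.continuousOn_uncurry hsol).mono (prod_mono Ioo_subset_Ico_self Subset.rfl)
  -- ### the rate interpolation on every sub-ball of `Q` (unit reference balls fit in `(0, T)`)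
  set κ : ℝ≥0∞ := 4 * volume (ball (0 : EuclideanSpace ℝ (Fin 3)) 1) ^ (1 / 4 : ℝ) *
    ENNReal.ofReal (C ^ (3 / 2 : ℝ)) with hκ
  have hκtop : κ ≠ ∞ := ENNReal.mul_ne_top (ENNReal.mul_ne_top ENNReal.ofNat_ne_top
    (ENNReal.rpow_ne_top_of_nonneg (by norm_num) measure_ball_lt_top.ne)) ENNReal.ofReal_ne_top
  have hinterp : ∀ (z' : ℝ × EuclideanSpace ℝ (Fin 3)) (ρ : ℝ), 0 < ρ →
      parabolicCylinder ρ z' ⊆ (QO : Set (ℝ × EuclideanSpace ℝ (Fin 3))) →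
      cknC ρ z' u ≤ κ * cknAEss ρ z' u ^ (3 / 4 : ℝ) := by
    intro z' ρ hρ hsub
    rw [hQOcoe] at hsub
    obtain ⟨h1, h2⟩ := margins_of_subset_slab hρ hsub
    have hρ1 : ρ ≤ 1 := by nlinarith
    -- the unit reference ball `Q(z', 1) ⊆ (0, T) × ℝ³`
    have hunit : parabolicCylinder 1 z' ⊆ Ioo 0 T ×ˢ (univ : Set (EuclideanSpace ℝ (Fin 3))) := by
      refine prod_mono (fun s hs => ⟨?_, lt_of_lt_of_le hs.2 h2⟩) (subset_univ _)
      have : z'.1 - 1 ^ 2 < s := hs.1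
      nlinarith
    have hmeas : AEStronglyMeasurable (uncurry u) (volume.restrict (parabolicCylinder 1 z')) :=
      (hcontu.mono hunit).aestronglyMeasurable (isOpen_parabolicCylinder 1 z').measurableSet
    have hrate' : ∀ s y, (s, y) ∈ parabolicCylinder 1 z' → ‖u s y‖ ≤ C / Real.sqrt (z'.1 - s) := by
      intro s y hsy
      have hs : s ∈ Ioo 0 T := (hunit hsy).1
      have hsz : s < z'.1 := (mem_parabolicCylinder.1 hsy).1.2
      refine (hrate s ⟨hs.1.le, hs.2⟩ y).trans ?_
      exact div_le_div_of_nonneg_left hC (Real.sqrt_pos.2 (by linarith))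
        (Real.sqrt_le_sqrt (by linarith))
    exact cknC_le_of_rate hC hmeas hrate' hρ (parabolicCylinder_mono_radius hρ1 hρ.le z')
  -- ### reference data at radii `≥ 1/2`, uniform in the centre
  set E₂ : ℝ≥0∞ := ENNReal.ofReal (2 * VectorCalculus.kineticEnergy (u 0)) with hE₂
  set P : ℝ≥0∞ := ∫⁻ z in Ioo 0 T ×ˢ (univ : Set (EuclideanSpace ℝ (Fin 3))),
    ‖q z.1 z.2‖ₑ ^ (3 / 2 : ℝ) with hP
  have hPtop : P ≠ ∞ :=
    (SereginSverak2002.lintegral_slab_gauged_pressure_lt_top one_pos hT hsol hLH).ne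
  set Dis : ℝ≥0∞ := ∫⁻ z in Ioo 0 T ×ˢ (univ : Set (EuclideanSpace ℝ (Fin 3))),
    ENNReal.ofReal (frobeniusNormSq (fderiv ℝ (u z.1) z.2)) with hDis
  have hDistop : Dis ≠ ∞ := (SereginSverak2002.lintegral_slab_frobeniusNormSq_fderiv_lt_top' hsol hLH).ne
  have h2i : (ENNReal.ofReal (1 / 2 : ℝ))⁻¹ ≠ ∞ :=
    ENNReal.inv_ne_top.2 (ENNReal.ofReal_pos.2 (by norm_num)).ne'
  have h2i2 : (ENNReal.ofReal (1 / 2 : ℝ) ^ 2)⁻¹ ≠ ∞ :=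
    ENNReal.inv_ne_top.2 (pow_ne_zero _ (ENNReal.ofReal_pos.2 (by norm_num)).ne')
  set A₀ : ℝ≥0∞ := (ENNReal.ofReal (1 / 2 : ℝ))⁻¹ * E₂ with hA₀
  have hA₀top : A₀ ≠ ∞ := ENNReal.mul_ne_top h2i ENNReal.ofReal_ne_top
  set D₀ : ℝ≥0∞ := (ENNReal.ofReal (1 / 2 : ℝ) ^ 2)⁻¹ * P with hD₀
  have hD₀top : D₀ ≠ ∞ := ENNReal.mul_ne_top h2i2 hPtop
  set E₀ : ℝ≥0∞ := (ENNReal.ofReal (1 / 2 : ℝ))⁻¹ * Dis with hE₀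
  have hE₀top : E₀ ≠ ∞ := ENNReal.mul_ne_top h2i hDistop
  -- `A ≤ A₀` on every ball of `Q` of radius `≥ 1/2` (energy class)
  have hdataA : ∀ (z' : ℝ × EuclideanSpace ℝ (Fin 3)) (ρ : ℝ), 1 / 2 ≤ ρ →
      parabolicCylinder ρ z' ⊆ (QO : Set (ℝ × EuclideanSpace ℝ (Fin 3))) → cknAEss ρ z' u ≤ A₀ := by
    intro z' ρ hρ hsub
    have hρ0 : 0 < ρ := lt_of_lt_of_le (by norm_num) hρ
    rw [hQOcoe] at hsub
    obtain ⟨h1, h2⟩ := margins_of_subset_slab hρ0 hsub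
    refine essSup_le_of_ae_le _ ?_
    filter_upwards [ae_restrict_mem measurableSet_Ioo] with t ht
    have htI : t ∈ Icc 0 T := ⟨by linarith [ht.1], by linarith [ht.2]⟩
    calc (ENNReal.ofReal ρ)⁻¹ * ∫⁻ x in ball z'.2 ρ, ‖u t x‖ₑ ^ 2
        ≤ (ENNReal.ofReal (1 / 2 : ℝ))⁻¹ * ∫⁻ x, ‖u t x‖ₑ ^ 2 :=
          mul_le_mul' (ENNReal.inv_le_inv.2 (ENNReal.ofReal_le_ofReal hρ))
            (setLIntegral_le_lintegral _ _)
      _ ≤ A₀ := mul_le_mul' le_rfl (SereginSverak2002.eEnergy_le zero_le_one hLH htI)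
  -- `D ≤ D₀` and `E ≤ E₀` likewise (global bounds on the slab)
  have hdataD : ∀ (z' : ℝ × EuclideanSpace ℝ (Fin 3)) (ρ : ℝ), 1 / 2 ≤ ρ →
      parabolicCylinder ρ z' ⊆ (QO : Set (ℝ × EuclideanSpace ℝ (Fin 3))) → cknD ρ z' q ≤ D₀ := by
    intro z' ρ hρ hsub
    rw [cknD, hD₀]
    refine mul_le_mul' (ENNReal.inv_le_inv.2 ?_) (lintegral_mono_set (hsub.trans hQOslab))
    gcongr
  have hdataE : ∀ (z' : ℝ × EuclideanSpace ℝ (Fin 3)) (ρ : ℝ), 1 / 2 ≤ ρ →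
      parabolicCylinder ρ z' ⊆ (QO : Set (ℝ × EuclideanSpace ℝ (Fin 3))) →
      cknE ρ z' (fun t x => fderiv ℝ (u t) x) ≤ E₀ := by
    intro z' ρ hρ hsub
    rw [cknE, hE₀]
    exact mul_le_mul' (ENNReal.inv_le_inv.2 (ENNReal.ofReal_le_ofReal hρ))
      (lintegral_mono_set (hsub.trans hQOslab))
  -- ### the uniform bound on small balls
  obtain ⟨K, hKtop, hK⟩ := uniform_bound_of_interp hsw hG hκtop hinterp hA₀top hD₀top
  set Kbig : ℝ≥0∞ := A₀ + κ * A₀ ^ (3 / 4 : ℝ) + 4 * D₀ + E₀ with hKbig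
  have hKbigtop : Kbig ≠ ∞ := by
    refine ENNReal.add_ne_top.2 ⟨ENNReal.add_ne_top.2 ⟨ENNReal.add_ne_top.2 ⟨hA₀top, ?_⟩, ?_⟩, hE₀top⟩
    · exact ENNReal.mul_ne_top hκtop (ENNReal.rpow_ne_top_of_nonneg (by norm_num) hA₀top)
    · exact ENNReal.mul_ne_top ENNReal.ofNat_ne_top hD₀top
  have htop : 4 * K + Kbig < ∞ :=
    (ENNReal.add_ne_top.2 ⟨ENNReal.mul_ne_top ENNReal.ofNat_ne_top hKtop, hKbigtop⟩).lt_top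
  -- measurability of the gauged pressure on `Q`
  have hqm : AEStronglyMeasurable (uncurry q)
      (volume.restrict (QO : Set (ℝ × EuclideanSpace ℝ (Fin 3)))) :=
    hsw.distributional.2.2.1.aestronglyMeasurable
  -- ### conclusion: every ball of the final slab `(T - 1/4, T) × ℝ³`
  refine lt_of_le_of_lt (typeIBound_le_iff.2 fun r hr z' hzr => ?_) htop
  obtain ⟨h1, h2⟩ := margins_of_subset_slab hr hzr
  have hrhalf : r ≤ 1 / 2 := by nlinarith
  -- room: `Q(z', ρ) ⊆ Q` for `ρ ≤ r + 1/2`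
  have hroom : ∀ ρ, 0 < ρ → ρ ≤ r + 1 / 2 →
      parabolicCylinder ρ z' ⊆ (QO : Set (ℝ × EuclideanSpace ℝ (Fin 3))) := by
    intro ρ hρ0 hρ
    rw [hQOcoe]
    refine prod_mono (fun s hs => ⟨?_, lt_of_lt_of_le hs.2 h2⟩) (subset_univ _)
    have : z'.1 - ρ ^ 2 < s := hs.1
    nlinarith
  have hsubr : parabolicCylinder r z' ⊆ (QO : Set (ℝ × EuclideanSpace ℝ (Fin 3))) :=
    hroom r hr (by linarith)
  -- `D_osc ≤ 4 D` on the ball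
  have hOsc : cknDOsc r z' q ≤ 4 * cknD r z' q :=
    cknDOsc_le_four_mul_cknD hr (hqm.mono_measure (Measure.restrict_mono hsubr le_rfl))
  rw [abScaledSum]
  -- the iteration started from the reference radius `r₀ = r + 1/2 ∈ [1/2, 1]`
  have hr₀ : 0 < r + 1 / 2 := by linarith
  have hsub₀ := hroom (r + 1 / 2) hr₀ le_rfl
  have hKr := hK z' (r + 1 / 2) hr₀ hsub₀ (hdataA z' _ (by linarith) hsub₀)
    (hdataD z' _ (by linarith) hsub₀) r ⟨hr, by linarith⟩
  calc cknAEss r z' u + cknC r z' u + cknDOsc r z' q + cknE r z' (fun t x => fderiv ℝ (u t) x)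
      ≤ 4 * cknAEss r z' u + 4 * cknC r z' u + 4 * cknD r z' q +
          4 * cknE r z' (fun t x => fderiv ℝ (u t) x) :=
        add_le_add (add_le_add (add_le_add (le_four_mul _) (le_four_mul _)) hOsc) (le_four_mul _)
    _ = 4 * (cknAEss r z' u + cknE r z' (fun t x => fderiv ℝ (u t) x) + cknC r z' u + cknD r z' q) := by
        ring
    _ ≤ 4 * K := by gcongr
    _ ≤ 4 * K + Kbig := le_self_add

end Summit.NavierStokesRegularity.NavierStokesRegularity.Theorems.TypeIliouvilleNoTypeII.EnergySlab

end
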